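import Mathlib
import Summits.Langlands.Langlands.Theorems.IwahoriTransientDictionaryEdge
import Summits.Langlands.Langlands.Theorems.IwahoriTransientSplitLevelFiniteness
import Summits.Langlands.Langlands.Theorems.IwahoriTransientRoots
import Literature.NumberTheory.Automorphic.AutomorphicRepsGLSatakeFlathProofs

/-!
# DAG edge — part 3/3: `SemistableShaping ⟸ W⁺ ∧ P ∧ L∤R ∧ CRD ∧ IWD-A ∧ IWD-B1a ∧ IWD-B1b ∧ IWD-B2` and `LevelFiniteness ⟸ … ∧ ILC`
(decomp-langlands, lens-3 gen 27)

The gen-26 composition `semistableShaping_of : W⁺ → hSat → S5 → SemistableShaping` (verbatim from HOME/lens-3/g26/dag/SemistableShapingOfAvatars.lean,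
whose algebraic parts landed as `Theorems.IwahoriTransient{Inertia,Roots,Galois}` p825046/p825047/p825709), Satake uniqueness (the tree's `hasSatakeParamAt_unique_holds`), and the
host composition through part 2's `iwahoriDictionary_of_host` and the tree's `closes_target`.  Sorry-free; axioms standard.
-/

set_option linter.dupNamespace false
set_option linter.unusedVariables false
set_option linter.unusedSectionVars false

namespace Summit.Langlands.Langlands.Theorems.IwahoriTransient

open scoped Polynomial Matrix Pointwise
open Polynomial

namespace DictEdge

/-! ## §E. Composition with the gen-26 edge: `SemistableShaping ⟸ W⁺ ∧ P ∧ L∤R ∧ CRD ∧ IWD-A ∧ IWD-B1a ∧ IWD-B1b ∧ IWD-B2` -/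

section Composition

/-- `Valued.v x ≤ 1 ↔ ‖x‖ ≤ 1`-type bridge (companion of the certificate's `valued_lt_iff`). -/
theorem valued_le_iff {ℓ : ℕ} [Fact ℓ.Prime] (x : PadicAlgCl ℓ) (r : NNReal) : Valued.v x ≤ r ↔ ‖x‖ ≤ (r : ℝ) := by
  rw [PadicAlgCl.valuation_def, ← NNReal.coe_le_coe, coe_nnnorm]

/-- COMPOSITION `W⁺ ∧ hSat ∧ S5 ⟹ SemistableShaping` — verbatim the gen-26 kernel-checked composition `Dag.semistableShaping_of`
(lens-3 g26, HOME/lens-3/g26/dag/SemistableShapingOfAvatars.lean; S1 = `frobeniusTransfer`, S2 = `rootPairMatching`, S3 = `quasiUnipotent_inertia`,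
S4 = `norm_root_charpoly_le_one` are tree theorems), copied here because cell evidence files are not importable. -/
theorem semistableShaping_of
    (hW : Summit.Langlands.Langlands.Theses.PrimeSwitchSplit.SatakeAvatarExistence)
    (hSat : ∀ (K : Type) [Field K] [NumberField K] (n : ℕ) (hcpt : Literature.NumberTheory.Automorphic.isCompact_glFiniteIntegralLevel n K) (π : Literature.NumberTheory.Automorphic.CuspidalAutomorphicRepData n K hcpt), π.1.hasSatakeParamAt_unique)
    (h5 : ∀ (K : Type) [Field K] [NumberField K] (n : ℕ) (hcpt : Literature.NumberTheory.Automorphic.isCompact_glFiniteIntegralLevel n K), 0 < n → ∀ (π : Literature.NumberTheory.Automorphic.CuspidalAutomorphicRepData n K hcpt), π.1.IsLAlgebraic → ∀ (ℓ : ℕ) [Fact ℓ.Prime] (ι : PadicAlgCl ℓ ≃+* ℂ) (ρ' : Literature.NumberTheory.GaloisRepresentations.FramedGaloisRep K (PadicAlgCl ℓ) n), ρ'.toGaloisRep.IsIrreducible → (∀ᶠ v : IsDedekindDomain.HeightOneSpectrum (NumberField.RingOfIntegers K) in Filter.cofinite, Summit.Langlands.SatakeFrobCompatibleAt ι π.1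 ρ' v) → ∀ v : IsDedekindDomain.HeightOneSpectrum (NumberField.RingOfIntegers K), ((ℓ : ℕ) : NumberField.RingOfIntegers K) ∉ v.asIdeal → (∀ 𝔓 ∈ v.primesAbove, ∀ τ ∈ 𝔓.inertia (Field.absoluteGaloisGroup K), IsNilpotent (((ρ' τ : GL (Fin n) (PadicAlgCl ℓ)) : Matrix (Fin n) (Fin n) (PadicAlgCl ℓ)) - 1)) → (∃ πv : Literature.NumberTheory.Automorphic.SmoothIrrep (Matrix.GeneralLinearGroup (Fin n) (v.adicCompletion K)), π.1.HasLocalComponentAt v πv.ρ ∧ ∃ w : πv.V, w ≠ 0 ∧ ∀ g ∈ Literature.NumberTheory.Automorphic.iwahoriGL n (v.adicCompletion K), πv.ρ g w = w) ∧ (Summit.Langlands.SatakeFrobCompatibleAt ι π.1 ρ' v ∨ ∀ 𝔓 ∈ v.primesAbove, ∀ σ : Field.absoluteGaloisGroup K, IsArithFrobAt (NumberField.RingOfIntegers K) σ 𝔓 → ∃ a b : PadicAlgCl ℓ, ({a, b} : Multiset (PadicAlgCl ℓ)) ≤ (Literature.NumberTheory.GaloisRepresentations.FramedRep.charpoly ρ'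 σ).roots ∧ a = (v.residueCard : PadicAlgCl ℓ) * b)) :
    id Summit.Langlands.Langlands.Theorems.IwahoriTransient.SemistableShaping := by
  dsimp only [id]
  intro K _ _ n hcpt hn ℓ _ ι ρ hirr hgeom hinf
  obtain ⟨hunr, hdR⟩ := hgeom
  have hℓ : (ℓ : NumberField.RingOfIntegers K) ≠ 0 := Nat.cast_ne_zero.mpr (Fact.out : ℓ.Prime).ne_zero
  -- the exceptional set: ramified places of ρ and places above ℓ
  set S₀ : Set (IsDedekindDomain.HeightOneSpectrum (NumberField.RingOfIntegers K)) := {v | ¬ ρ.IsUnramifiedAt v ∨ ((ℓ : ℕ) : NumberField.RingOfIntegers K) ∈ v.asIdeal} with hS₀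
  have hS₀fin : S₀.Finite := by
    have hA : {v : IsDedekindDomain.HeightOneSpectrum (NumberField.RingOfIntegers K) | ¬ ρ.IsUnramifiedAt v}.Finite := Filter.eventually_cofinite.mp hunr
    have hB : {v : IsDedekindDomain.HeightOneSpectrum (NumberField.RingOfIntegers K) | ((ℓ : ℕ) : NumberField.RingOfIntegers K) ∈ v.asIdeal}.Finite := by
      refine (Ideal.finite_factors (I := Ideal.span {((ℓ : ℕ) : NumberField.RingOfIntegers K)}) ?_).subset fun v hv => ?_
      · simpa [Ideal.span_singleton_eq_bot] using hℓ
      · exact Ideal.dvd_span_singleton.mpr hv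
    exact (hA.union hB).subset fun v hv => hv
  refine ⟨S₀, hS₀fin, fun r hr => ?_⟩
  -- radius bookkeeping
  have hℓpos : (0 : NNReal) < (ℓ : NNReal) := by exact_mod_cast (Fact.out : ℓ.Prime).pos
  set m : NNReal := min r (min (r ^ (n * n)) (((ℓ : NNReal)⁻¹) ^ n)) with hm
  have hmpos : 0 < m := lt_min hr (lt_min (pow_pos hr (n * n)) (pow_pos (inv_pos.mpr hℓpos) n))
  have hm1 : m ≤ 1 := (min_le_right _ _).trans ((min_le_right _ _).trans
    (pow_le_one₀ (by positivity) (inv_le_one_of_one_le₀ (by exact_mod_cast (Fact.out : ℓ.Prime).one_lt.le))))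
  set r'' : NNReal := m / 2 with hr''
  have hr''pos : 0 < r'' := half_pos hmpos
  have hr''m : r'' < m := half_lt_self hmpos
  have hr''r : r'' < r := hr''m.trans_le (min_le_left _ _)
  have hr''rn : r'' < r ^ (n * n) := hr''m.trans_le ((min_le_right _ _).trans (min_le_left _ _))
  have hr''1 : r'' ≤ 1 := hr''m.le.trans hm1
  have hr''ℓ : r'' < ((ℓ : NNReal)⁻¹) ^ n := hr''m.trans_le ((min_le_right _ _).trans (min_le_right _ _))
  -- the approximant at depth r'' and its avatar
  obtain ⟨π, hLalg, hclose⟩ := hinf r'' hr''pos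
  obtain ⟨ρ', hirr', hcompat⟩ := hW K n hcpt hn π hLalg ℓ ι
  refine ⟨π, hLalg, ?_, fun v hv => ?_⟩
  · -- a.e. closeness at depth r from depth r''
    refine hclose.mono fun v hv0 => ?_
    obtain ⟨α, hα, hcl⟩ := hv0
    exact ⟨α, hα, fun 𝔓 h𝔓 σ hσ i => (hcl 𝔓 h𝔓 σ hσ i).trans hr''r⟩
  · -- a place outside S₀: ρ unramified at v and v ∤ ℓ
    have hv' : ρ.IsUnramifiedAt v ∧ ((ℓ : ℕ) : NumberField.RingOfIntegers K) ∉ v.asIdeal := by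
      by_contra hcon
      apply hv
      rw [hS₀, Set.mem_setOf_eq]
      tauto
    obtain ⟨hunrv, hvℓ⟩ := hv'
    -- (A) a.e. Frobenius closeness of charpoly ρ and charpoly ρ' at depth r'' (Satake uniqueness), then EVERYWHERE by S1
    have hae : ∀ᶠ w : IsDedekindDomain.HeightOneSpectrum (NumberField.RingOfIntegers K) in Filter.cofinite, ∀ 𝔓 ∈ w.primesAbove, ∀ σ : Field.absoluteGaloisGroup K,
        IsArithFrobAt (NumberField.RingOfIntegers K) σ 𝔓 → ∀ i : ℕ, Valued.v ((Literature.NumberTheory.GaloisRepresentations.FramedRep.charpoly ρ σ - Literature.NumberTheory.GaloisRepresentations.FramedRep.charpoly ρ' σ).coeff i) < r'' := by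
      refine (hclose.and hcompat).mono fun w hw => ?_
      obtain ⟨⟨α, hα, hcl⟩, ⟨β, hβ, _, hchar⟩⟩ := hw
      have hαβ : α = β := hSat K n hcpt π hα hβ
      intro 𝔓 h𝔓 σ hσ i
      rw [hchar 𝔓 h𝔓 σ hσ, ← hαβ]
      exact hcl 𝔓 h𝔓 σ hσ i
    have hglob : ∀ (σ : Field.absoluteGaloisGroup K) (i : ℕ), Valued.v ((Literature.NumberTheory.GaloisRepresentations.FramedRep.charpoly ρ σ - Literature.NumberTheory.GaloisRepresentations.FramedRep.charpoly ρ' σ).coeff i) < r'' := frobeniusTransfer ρ ρ' r'' hae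
    -- (B) inertia at v acts unipotently through ρ' (part 1 MAIN + S3)
    have hunip : ∀ 𝔓 ∈ v.primesAbove, ∀ τ ∈ 𝔓.inertia (Field.absoluteGaloisGroup K), IsNilpotent (((ρ' τ : GL (Fin n) (PadicAlgCl ℓ)) : Matrix (Fin n) (Fin n) (PadicAlgCl ℓ)) - 1) := by
      intro 𝔓 h𝔓 τ hτ
      have hρτ : ρ τ = 1 := hunrv 𝔓 h𝔓 τ hτ
      have hPτ : Literature.NumberTheory.GaloisRepresentations.FramedRep.charpoly ρ τ = (Polynomial.X - Polynomial.C 1) ^ n := by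
        simp only [Literature.NumberTheory.GaloisRepresentations.FramedRep.charpoly, hρτ, Units.val_one, Matrix.charpoly_one, Fintype.card_fin, map_one]
      refine isNilpotent_sub_one_of_valued_lt _ (quasiUnipotent_inertia ρ' v hvℓ h𝔓 hτ) fun i => ?_
      have hneg : (((ρ' τ : GL (Fin n) (PadicAlgCl ℓ)) : Matrix (Fin n) (Fin n) (PadicAlgCl ℓ)).charpoly - (Polynomial.X - Polynomial.C 1) ^ n)
          = -(Literature.NumberTheory.GaloisRepresentations.FramedRep.charpoly ρ τ - Literature.NumberTheory.GaloisRepresentations.FramedRep.charpoly ρ' τ) := by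
        rw [hPτ]; simp only [Literature.NumberTheory.GaloisRepresentations.FramedRep.charpoly, neg_sub]
      rw [hneg, Polynomial.coeff_neg, Valuation.map_neg]
      exact (hglob τ i).trans hr''ℓ
    -- (C) the dictionary at v
    obtain ⟨hIW, hdict⟩ := h5 K n hcpt hn π hLalg ℓ ι ρ' hirr' hcompat v hvℓ hunip
    rcases hdict with hsph | hpair
    · -- spherical-compatible at v: DEEP closeness (left disjunct)
      left
      obtain ⟨β, hβ, _, hchar⟩ := hsph
      refine ⟨β, hβ, fun 𝔓 h𝔓 σ hσ i => ?_⟩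
      rw [← hchar 𝔓 h𝔓 σ hσ]
      exact (hglob σ i).trans hr''r
    · -- Iwahori, non-spherical: exact q-pair for ρ' transfers to an approximate one for ρ (right disjunct)
      right
      refine ⟨hIW, fun 𝔓 h𝔓 σ hσ => ?_⟩
      obtain ⟨a, b, hab, hq⟩ := hpair 𝔓 h𝔓 σ hσ
      have hn0 : n ≠ 0 := Nat.pos_iff_ne_zero.mp hn
      have hPm : (Literature.NumberTheory.GaloisRepresentations.FramedRep.charpoly ρ' σ).Monic := Matrix.charpoly_monic _
      have hQm : (Literature.NumberTheory.GaloisRepresentations.FramedRep.charpoly ρ σ).Monic := Matrix.charpoly_monic _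
      have hPd : (Literature.NumberTheory.GaloisRepresentations.FramedRep.charpoly ρ' σ).natDegree = n := by
        rw [Literature.NumberTheory.GaloisRepresentations.FramedRep.charpoly, Matrix.charpoly_natDegree_eq_dim, Fintype.card_fin]
      have hQd : (Literature.NumberTheory.GaloisRepresentations.FramedRep.charpoly ρ σ).natDegree = n := by
        rw [Literature.NumberTheory.GaloisRepresentations.FramedRep.charpoly, Matrix.charpoly_natDegree_eq_dim, Fintype.card_fin]
      have hcoef : ∀ i : ℕ, ‖(Literature.NumberTheory.GaloisRepresentations.FramedRep.charpoly ρ' σ - Literature.NumberTheory.GaloisRepresentations.FramedRep.charpoly ρ σ).coeff i‖ < (r'' : ℝ) := by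
        intro i
        rw [← neg_sub, Polynomial.coeff_neg, norm_neg, ← valued_lt_iff]
        exact hglob σ i
      obtain ⟨a', b', hab', ha', hb'⟩ := rootPairMatching hn0 hPm hQm hPd hQd (fun β hβ => norm_root_charpoly_le_one ρ' σ hβ)
        (fun β hβ => norm_root_charpoly_le_one ρ σ hβ) (by exact_mod_cast hr''pos) (by exact_mod_cast hr''1) hcoef hab
      refine ⟨a', b', hab', ?_⟩
      -- v(a' − q b') ≤ max (v(a' − a)) (v q · v(b − b')) < r
      have hr1 : (r : ℝ) ≤ 1 ∨ (1 : ℝ) < r := le_or_gt _ _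
      have hrnn : ((r'' : NNReal) : ℝ) < ((r : NNReal) : ℝ) ^ (n * n) := by exact_mod_cast hr''rn
      have hrr : ((r'' : NNReal) : ℝ) < ((r : NNReal) : ℝ) := by exact_mod_cast hr''r
      have hnn0 : n * n ≠ 0 := Nat.mul_ne_zero hn0 hn0
      -- `x^k < r'' ⇒ x < r` for k = n and k = n·n: if `r ≤ 1` use `r'' < r^(n n) ≤ r^k`; if `r > 1` use `x^k < r'' ≤ 1/2 < 1 ⇒ x < 1 < r`
      have hroot : ∀ (x : ℝ) (k : ℕ), 0 ≤ x → k ≠ 0 → k ≤ n * n → x ^ k < (r'' : ℝ) → x < (r : ℝ) := by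
        intro x k hx hk hkn hxk
        rcases hr1 with hr1 | hr1
        · have hle : ((r : NNReal) : ℝ) ^ (n * n) ≤ ((r : NNReal) : ℝ) ^ k := pow_le_pow_of_le_one (NNReal.coe_nonneg r) hr1 hkn
          exact lt_of_pow_lt_pow_left₀ k (NNReal.coe_nonneg r) ((hxk.trans hrnn).trans_le hle)
        · have hx1 : x ^ k < 1 := hxk.trans_le (by exact_mod_cast hr''1)
          exact (lt_of_pow_lt_pow_left₀ k zero_le_one (by rwa [one_pow])).trans hr1
      have ha'' : ‖a - a'‖ < (r : ℝ) := hroot _ n (norm_nonneg _) hn0 (Nat.le_mul_self n) ha'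
      have hb'' : ‖b - b'‖ < (r : ℝ) := hroot _ (n * n) (norm_nonneg _) hnn0 le_rfl hb'
      have hva : Valued.v (a' - a) < r := by rw [valued_lt_iff, norm_sub_rev]; exact ha''
      have hvb : Valued.v (b - b') < r := by rw [valued_lt_iff]; exact hb''
      have hvq : Valued.v ((v.residueCard : PadicAlgCl ℓ)) ≤ 1 :=
        (valued_le_iff _ 1).mpr (by simpa using norm_natCast_le_one (ℓ := ℓ) v.residueCard)
      have hkey : a' - (v.residueCard : PadicAlgCl ℓ) * b' = (a' - a) + (v.residueCard : PadicAlgCl ℓ) * (b - b') := by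
        rw [hq]; ring
      rw [hkey]
      refine (Valuation.map_add _ _ _).trans_lt (max_lt hva ?_)
      rw [Valuation.map_mul]
      calc Valued.v (v.residueCard : PadicAlgCl ℓ) * Valued.v (b - b') ≤ 1 * Valued.v (b - b') := by
            gcongr
        _ < r := by rw [one_mul]; exact hvb

/-- **`SemistableShaping ⟸ W⁺ ∧ P ∧ L∤R ∧ CRD ∧ IWD-A ∧ IWD-B1a ∧ IWD-B1b ∧ IWD-B2`** — the gen-25 deciding piece SSH of U = `LevelFiniteness` (27042)
from four N0 host items and four junction cells (three print, one print-at-rank-one / tree-above); no residual of the lens-3 chain g24→g27 on the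
SSH side remains un-typed. -/
theorem semistableShaping_of_host
    (hW : Summit.Langlands.Langlands.Theses.PrimeSwitchSplit.SatakeAvatarExistence)
    (hP : Summit.Langlands.Langlands.Theses.PrimeSwitchSplit.PadicMemberCompatibility)
    (hLR : Summit.Langlands.Langlands.Theses.PrimeSwitchSplit.CompatibilityAwayFromLR)
    (hCRD : Summit.Langlands.Langlands.Theses.PrimeSwitchSplit.CanonicalReciprocityData)
    (hA : IwahoriFixedOfInertiaTrivialParameter) (hB1a : SphericalOfUnramifiedParameter)
    (hB1b : UnramifiedOfSphericalLocalComponent) (hB2 : SatakeOfSphericalLocalGlobal) :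
    Summit.Langlands.Langlands.Theorems.IwahoriTransient.SemistableShaping :=
  semistableShaping_of hW
    (fun K _ _ n hcpt π => Literature.NumberTheory.Automorphic.AutomorphicRepData.hasSatakeParamAt_unique_holds π.1)
    (iwahoriDictionary_of_host hCRD hP hLR hA hB1a hB1b hB2)

/-- … and with ILC (gen-25 `IwahoriLevelConfinement`, itself ⟸ BNS ∧ NBC by the landed `BanalLevelSplit` twin p823743) the root-adjacent
U = `AuxiliaryLevelSplit.LevelFiniteness` (27042), through the tree's `closes_target`. -/
theorem levelFiniteness_of_host
    (hW : Summit.Langlands.Langlands.Theses.PrimeSwitchSplit.SatakeAvatarExistence)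
    (hP : Summit.Langlands.Langlands.Theses.PrimeSwitchSplit.PadicMemberCompatibility)
    (hLR : Summit.Langlands.Langlands.Theses.PrimeSwitchSplit.CompatibilityAwayFromLR)
    (hCRD : Summit.Langlands.Langlands.Theses.PrimeSwitchSplit.CanonicalReciprocityData)
    (hA : IwahoriFixedOfInertiaTrivialParameter) (hB1a : SphericalOfUnramifiedParameter)
    (hB1b : UnramifiedOfSphericalLocalComponent) (hB2 : SatakeOfSphericalLocalGlobal)
    (hILC : Summit.Langlands.Langlands.Theorems.IwahoriTransient.IwahoriLevelConfinement) :
    Summit.Langlands.Langlands.Theses.AuxiliaryLevelSplit.LevelFiniteness :=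
  closes_target (semistableShaping_of_host hW hP hLR hCRD hA hB1a hB1b hB2) hILC

end Composition

end DictEdge

end Summit.Langlands.Langlands.Theorems.IwahoriTransient

#print axioms Summit.Langlands.Langlands.Theorems.IwahoriTransient.DictEdge.semistableShaping_of_host
#print axioms Summit.Langlands.Langlands.Theorems.IwahoriTransient.DictEdge.levelFiniteness_of_host
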